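import Summits.AtomisticToContinuum.Crystallization.Theses.ThreeConeCertificate
import Summits.AtomisticToContinuum.Crystallization.Theorems.SlackRigidity.Negative.WithoutRotations
import Literature.MathematicalPhysics.StatisticalMechanics.LennardJonesClusters
import Literature.MathematicalPhysics.StatisticalMechanics.MuGroundStateConfiguration
import Literature.MathematicalPhysics.StatisticalMechanics.LocalMatchingCompactness
import Literature.MathematicalPhysics.StatisticalMechanics.BarlowStacking
import Literature.MathematicalPhysics.StatisticalMechanics.HcpHomogeneous

/-!
# Line `signed-root-silent-field` — skeleton for the crux `ThreeConeCertificate.SlackRigidity`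
(crux item stmt-AtomisticToContinuum-11960, rank 4, route `route-AtomisticToContinuum-ThreeConeCertificate`)

Crux (FIXED, by name; readback `SlackRigidityNegative.slackRigidity_iff : SlackRigidity ↔ ∃ P, RigidFor P`
is `Iff.rfl`): there is ONE periodic `P` such that for every `(R, ε)`, along every injective sequence
`x N : Fin N → ℝ³` with energy excess `o(N)`, all but `o(N)` particles have their `R`-environment two-way
`ε`-matched to `x i + A (P.points)` for some linear isometry `A`.

Idea (card `Ideas/signed-root-silent-field.md`; triage r1-1/2/3: pass, merged with `smeared-bochner-field` (tool)
and, for its selection half, with `rod-sphere-progressions` / `rod-parseval-fault-pricing`): read the exact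
three-cone certificate `V_LJ = g + U + f` of crux 11959 in LOCALISED form — the positive-type part as a
convolution square `f = K ⋆ K` of a radial kernel `K = 𝓕⁻¹(±√f̂) = O(r⁻⁴)` (signed root: the sign flips
across each forced Bragg sphere of `f̂`, so `√f̂`'s conical kinks disappear and `K ∈ L¹`), the `g`-part as a
one-centre star functional `F ≥ 0`.  Then the total slack `E_N(x) − N·e(P) = Σ_i F(star_i) + Σ_{i<j} U(r_ij)
+ ½ ∫ Φ_x²`, `Φ_x = Σ_j K(|· − x_j|)`, is a sum of LOCAL NONNEGATIVE densities; exactness of the certificate at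
`P = hcp*` is equivalent to SILENCE `Σ_{p ∈ hcp*} K(|y − p|) ≡ 0`; and `SlackRigidity` is the compactness
shadow of a deterministic statement about single infinite configurations: a uniformly discrete `X ∋ 0` with
tight stars, `U`-tight pairs and `Φ_X ≡ 0` is a (linearly) rotated copy of `hcp*`.  Stacking selection is done
by `f` alone, through a FINITE reciprocal-space condition: `f̂ > 0` on the `(10)` rod segment `|ζ| ≤ 2` off the
forced hcp Bragg spheres (`RodStrict`), after which a bounded `±1`/cube-root phase sequence annihilated by the
rod multiplier is `2`-periodic (`rodAlias_onlyHcp`, PROVED in `IdeatorOneSketch`; uniform in the relaxed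
`c/a` window `τ = 16h²/3a² ∈ (3, 4]`, PROVED in the triage file `RodOne.lean`).

THE LINE (5 registered stubs, glued by `SlackRigidity_of`, kernel-checked, no `sorry` of its own):
* `stub_certificate`      (S1, XL — the transfer `C⁺`; = crux 11959 STRENGTHENED by localisation + weak strictness):
  `∃` a `LocalisedCertificate` — relaxed hcp spacings `(a, h)` in the Barlow window, split `V_LJ = g + U + f` on
  `(0, ∞)`, `U ≥ 0` continuous, `f = K ⋆ K` with `K` continuous and `|K(r)| ≤ C_K (1 + r)⁻⁴`, star functional
  `F ≥ 0` certifying `g` (`Σ_i F(star_i) ≤ Σ_{i<j} g + cN`), exactness `c + f(0)/2 = −e(hcp(a,h))`, `F` lower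
  semicontinuous in the local matching topology on `1/3`-separated stars, WEAK TIGHT LOCUS (an `F`-tight,
  `U`-tight `1/3`-separated `ρ'`-star is congruent to a Barlow `(a,h)`-environment), ROD STRICTNESS of `𝓕K`.
* `stub_energyUpperBound`  (S2, M — verbatim the route's support item `TrialStateUpper`, stmt-11963; readback
  `energyUpperBound_iff` is `Iff.rfl`): `limsup E(N)/N ≤ e(Q)` for every periodic `Q`.
* `stub_extraction`        (S3, L — Markov on the three local densities, `1/3`-thinning by the removal inequality,
  rooted local-rubber compactness `exists_subseq_forall_eventually_ballMatch`, continuity of the three tight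
  conditions; the energy hypothesis of the crux is consumed HERE): certificate + S2-at-`P` + `¬ RigidFor P` ⇒ a
  `1/3`-separated zero-slack configuration `X ∋ 0` (tight stars, `U`-tight pairs, silent) NOT root-matched to
  `P` at some `(R, ε)`.
* `stub_layering`          (S4, M–L — local-to-global for exact Barlow environments of radius `≥ 2a`, Hales's
  propagation `HalesDSP_layerPackings_holds` re-run at relaxed `c/a`): every `ρ'`-star of `X` congruent to a
  Barlow `(a,h)`-environment ⇒ `X` is a rigidly moved `barlowStacking a h s`.
* `stub_silentBarlowIsHcp` (S5, L — the card's Wiener/rod step: layer sums, partial Fourier transform, 1-D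
  `L¹`-Wiener division on the rod, support on `{ζ ∈ {0,1} mod 2}` by the rod-alias arithmetic, boundedness ⇒
  `2`-periodic phases ⇒ alternating Hägg word; hcp homogeneity `hcpStacking_homogeneous` gives the LINEAR `A`;
  the isometry of the crux is produced HERE): a silent rigidly moved Barlow stacking through `0`, for a kernel
  with `RodStrict`, is `B '' (hcpPeriodicConfiguration).points` for a linear isometry `B`.
* `SlackRigidity_of : stub_certificate → … → stub_silentBarlowIsHcp → SlackRigidity` — real proof (~30 lines):
  witness `P := hcpPeriodicConfiguration (a, h)` of S1; by contradiction S3 extracts `X`; S1's tight locus feeds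
  S4; S5 makes `X = B '' P.points`; a rotated copy of `P` is root-matched at every `(R, ε)` (`rootMatched_image`).
  `slackRigidity_skeleton` applies it to the literal stubs; `certificate_implies_exactCertificate` (sorry-free)
  records that S1 is crux 11959 strengthened (smearing ⇒ positive type, `F ≥ 0` ⇒ `c`-stability).

Disproof.lean (cdisprove cycle 1, NO KILL) honoured — see the line card § Disproof used: energy enters only S3
(`not_rigidForWithoutEnergy`), the isometry is produced by S5 (`not_rigidForWithoutRotations`), the witness is
`hcpPeriodicConfiguration` through `0`, vertex-transitive (`zero_mem_points_of_rigidFor`,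
`rigidFor_vertexTransitive`, `hcpStacking_homogeneous`), RigidFor is claimed for ONE `P` (`not_forall_rigidFor`).
The landed Negative lemmas (`Theorems/SlackRigidity/Negative/*`, imported above) refute only the energy-free,
rotation-free and `∀ P` variants; no stub is an instance of them.  Negatives 3506 / 4146: every counting /
matching statement here is over `1/3`-SEPARATED sets (triage r1 finding on `CountingGlue`), and nothing tolerant
is asserted at `η > 0`.
-/

noncomputable section

open scoped BigOperators Topology FourierTransform
open MeasureTheory Filter Set Metric
open Literature.MathematicalPhysics.StatisticalMechanics
open Summit.AtomisticToContinuum.Crystallization.Theses.ThreeConeCertificate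
  (SlackRigidity ExactCertificate TrialStateUpper)
open Summit.AtomisticToContinuum.Crystallization.Theorems.SlackRigidityNegative
  (Good badCount BadFractionVanishes ExcessVanishes RigidFor slackRigidity_iff)

namespace Summit.AtomisticToContinuum.Crystallization.Cruxes.SlackRigidity.SignedRootSilentField

set_option linter.unusedVariables false

local notation "E3" => EuclideanSpace ℝ (Fin 3)

/-! ### Objects of the line (transparent definitions over tree declarations) -/

/-- `X` is `δ`-separated: distinct points are at distance `≥ δ` (the quantitative form of
`UniformlyDiscrete`; `δ = 1/3` is the Lennard-Jones ground-state separation of the tree,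
`LennardJonesMinimalDistance_holds`, and what `1/3`-thinning of near-minimisers delivers). -/
def Sep (δ : ℝ) (X : Set E3) : Prop :=
  ∀ p ∈ X, ∀ q ∈ X, p ≠ q → δ ≤ dist p q

/-- The RECENTRED `ρ'`-STAR of `X` at `p`: the points of `X` in the closed ball `B(p, ρ')`, translated by `−p`
(so `0 ∈ starAt X p ρ'` when `p ∈ X`).  For a finite configuration `x`, `starAt (range x) (x i) ρ'` is the
one-centre environment a fair-share functional prices. -/
def starAt (X : Set E3) (p : E3) (ρ' : ℝ) : Set E3 :=
  (fun q => q - p) '' (X ∩ closedBall p ρ')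

/-- The rooted configuration `X ∋ 0` is `(R, ε)`-matched AT THE ROOT to a linearly rotated copy of `P`
(the crux's two-way matching predicate for the particle sitting at `0`, configuration given as a set). -/
def RootMatched (P : PeriodicConfiguration 3) (R ε : ℝ) (X : Set E3) : Prop :=
  ∃ A : E3 →ₗᵢ[ℝ] E3, (∀ p ∈ P.points, ‖p‖ ≤ R → ∃ q ∈ X, dist q (A p) ≤ ε) ∧
    (∀ q ∈ X, ‖q‖ ≤ R → ∃ p ∈ P.points, dist q (A p) ≤ ε)

/-- `f` (radial profile) is the CONVOLUTION SQUARE of the radial kernel `K` on `ℝ³`: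
`f(|u − v|) = ∫ K(|y − u|) K(|y − v|) dy` for all `u, v` (products integrable).  On the Fourier side
`f̂ = (𝓕K)²` with `𝓕K` real radial — the signed root `±√f̂` of the card (verbatim `IsSmearingOf` of
`IdeatorThreeSketch`, where the smearing identity `Σᵢ Σⱼ wᵢ wⱼ f(|yᵢ − yⱼ|) = ∫ (Σⱼ wⱼ K(|z − yⱼ|))² dz`
is PROVED; re-proved below as `smearing_identity`). -/
def IsSmearingOf (f K : ℝ → ℝ) : Prop :=
  (∀ u v : E3, Integrable (fun y : E3 => K ‖y - u‖ * K ‖y - v‖)) ∧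
  ∀ u v : E3, f (dist u v) = ∫ y : E3, K ‖y - u‖ * K ‖y - v‖

/-- `t` is the SQUARED RADIUS OF A NON-EXTINCT BRAGG VECTOR of `hcp(a, h)` (in-layer spacing `a`, layer
spacing `h`, Mathlib's `𝓕` convention `e^{−2πi⟨x,ξ⟩}`, no `2π` in reciprocal vectors): reciprocal vectors are
`(G, l/(2h))`, `G = m₁u* + m₂v*` in the dual of the triangular lattice, `|G|² = 4(m₁² − m₁m₂ + m₂²)/(3a²)`,
`⟨G, w⟩ = (m₁ + m₂)/3` for the letter offset `w = barlowOffset a`; the two-point hcp motif `{0, w + h e₃}`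
extinguishes exactly the vectors with `3 ∣ m₁ + m₂` and `l` odd. -/
def IsHcpBraggSq (a h t : ℝ) : Prop :=
  ∃ m₁ m₂ l : ℤ, (3 ∣ m₁ + m₂ → Even l) ∧
    t = 4 * ((m₁ : ℝ) ^ 2 - m₁ * m₂ + (m₂ : ℝ) ^ 2) / (3 * a ^ 2) + (l : ℝ) ^ 2 / (4 * h ^ 2)

/-- ROD STRICTNESS of the kernel (the card's selection demand on crux 11959's `f̂ = (𝓕K)²`, in the sharpened
finite form of triage r1-2/3 and `RodOne.lean`): the Fourier transform of `y ↦ K(|y|)` does not vanish on the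
`(10)`-rod shell `4/(3a²) ≤ |ξ|² ≤ 4/(3a²) + 1/h²` (rod heights `|ζ| ≤ 2`, `ζ = 2h ξ₃`) except on the forced
hcp Bragg spheres.  Since `𝓕K` is radial this is a condition on finitely many radial intervals. -/
def RodStrict (a h : ℝ) (K : ℝ → ℝ) : Prop :=
  ∀ v : E3, 4 / (3 * a ^ 2) ≤ ‖v‖ ^ 2 → ‖v‖ ^ 2 ≤ 4 / (3 * a ^ 2) + 1 / h ^ 2 →
    ¬ IsHcpBraggSq a h (‖v‖ ^ 2) → 𝓕 (fun y : E3 => (K ‖y‖ : ℂ)) v ≠ 0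

/-- **The localised exact certificate** (the line's `C⁺`; data `(a, h, ρ, c, ρ', C_K, g, U, f, K, F)`):
1. `window`/`radius`: relaxed-hcp spacings with `h²/a² ∈ (9/16, 3/4]` (ideal `2/3`; LJ: `0.6666`), star radius
   `ρ' ≥ 2a`;
2. `split`, `U_nonneg`, `U_cont`, `g_range`: `V_LJ = g + U + f` on `(0,∞)`, `U ≥ 0` continuous there, `g ≡ 0`
   on `[ρ, ∞)` (clauses of `ExactCertificate`);
3. `smear`, `K_cont`, `K_decay`: `f = K ⋆ K` with a continuous kernel `|K(r)| ≤ C_K (1+r)⁻⁴` (signed root;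
   `a₂ > 0` in `f̂ = a₂|ξ|² − a₃|ξ|³ + …` gives exactly `r⁻⁴`);
4. `F_nonneg`, `F_certifies`: the one-centre form of `c`-stability — `F ≥ 0` on stars and
   `Σ_i F(starAt (range x) (x i) ρ') ≤ Σ_{i<j} g + cN` for injective `x` (fair-share reapportioning; this is
   how `c(g)` is certified anyway);
5. `exact`: `c + f(0)/2 = −e(hcpPeriodicConfiguration a h)` (zero duality gap at the relaxed hcp);
6. `F_lsc`: `F ∘ star` is lower semicontinuous at every `1/3`-separated rooted set in the local matching
   topology at radius `ρ' + 1` (cut-offs continuous and vanishing before `ρ'`);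
7. `tight` (WEAK TIGHT LOCUS): a `1/3`-separated star that is `F`-tight and `U`-tight is congruent, by a linear
   isometry, to the `ρ'`-environment of some point of some Barlow stacking `barlowStacking a h s` (h- or c-type
   environments both allowed: `g`, `U` may be stacking-blind);
8. `rod_strict`: `RodStrict a h K`. -/
structure LocalisedCertificate (a h ρ c ρ' CK : ℝ) (g U f K : ℝ → ℝ) (F : Set E3 → ℝ) : Prop where
  a_pos : 0 < a
  h_pos : 0 < h
  window : 9 * a ^ 2 < 16 * h ^ 2 ∧ 4 * h ^ 2 ≤ 3 * a ^ 2
  radius : 2 * a ≤ ρ'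
  split : ∀ r : ℝ, 0 < r → lennardJones r = g r + U r + f r
  U_nonneg : ∀ r : ℝ, 0 < r → 0 ≤ U r
  U_cont : ContinuousOn U (Ioi 0)
  g_range : ∀ r : ℝ, ρ ≤ r → g r = 0
  smear : IsSmearingOf f K
  K_cont : Continuous K
  K_decay : ∀ r : ℝ, 0 ≤ r → |K r| ≤ CK / (1 + r) ^ 4
  F_nonneg : ∀ S : Set E3, 0 ≤ F S
  F_certifies : ∀ (N : ℕ) (x : Fin N → E3), Function.Injective x →
    ∑ i, F (starAt (range x) (x i) ρ') ≤ interactionEnergy g x + c * N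
  exact : c + f 0 / 2 = -((hcpPeriodicConfiguration a_pos.ne' h_pos.ne').energyPerParticle lennardJones)
  F_lsc : ∀ Y : Set E3, Sep (1 / 3) Y → (0 : E3) ∈ Y → ∀ ε : ℝ, 0 < ε → ∃ η : ℝ, 0 < η ∧
    ∀ Y' : Set E3, Sep (1 / 3) Y' → (0 : E3) ∈ Y' → BallMatch η (ρ' + 1) (0 : E3) Y' Y →
      F (starAt Y 0 ρ') ≤ F (starAt Y' 0 ρ') + ε
  tight : ∀ Y : Set E3, Sep (1 / 3) Y → ∀ p ∈ Y, F (starAt Y p ρ') = 0 →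
    (∀ q ∈ Y, ∀ q' ∈ Y, dist q p ≤ ρ' → dist q' p ≤ ρ' → q ≠ q' → U (dist q q') = 0) →
    ∃ s : ℤ → ℤ, IsHaggSeq s ∧ ∃ b ∈ barlowStacking a h s, ∃ A : E3 →ₗᵢ[ℝ] E3,
      starAt Y p ρ' = A '' starAt (barlowStacking a h s) b ρ'
  rod_strict : RodStrict a h K

/-! ### The five statements of the line -/

/-- **Statement 1 (S1, `stub_certificate`, XL — the transfer `C⁺`).**  An exact three-cone certificate for
Lennard-Jones exists IN LOCALISED FORM with the weak strictness the rigidity argument needs: see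
`LocalisedCertificate`.  It implies crux 11959 `ExactCertificate` (`certificate_implies_exactCertificate`,
proved below) and strengthens it by (3) a smeared `f` with an `O(r⁻⁴)` kernel, (4) star-form certification of
`c(g)`, (6) continuity of `F`, (7) the weak tight locus, (8) rod strictness.  Why plausibly true: every known
design of the LP dual (Cohn–Kumar-type one-sided Bragg interpolation, `f̂ ≥ 0` smooth with exactly quadratic
forced zeros and `a₂ > 0` at `0`) has (3) and (8) generically; (4),(6) are the form in which `c(g)` would be
certified (fair shares with continuous cut-offs); (7) is the honest bet — the LP-chosen `g`, `U` may be
stacking-blind but must not admit a tight `1/3`-separated NON-Barlow star (surfaces/vacancies/interstitials pay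
`c/2`, `|g(a)|/2`, the core).  Why it might fail: as 11959 (triple complementary slackness at finite `ρ`), plus a
tight frustrated (icosahedral-fragment) star of `F` at the design radius.  Sources: CohnKumar2006 §9,
CohnEtAl2019, Ruelle1969 Prop. 3.2.7, Ehm–Gneiting–Richards 2004 doi:10.1090/S0002-9947-04-03502-0 (convolution
roots of radial positive definite functions), route dossier. -/
def CertificateExists : Prop :=
  ∃ (a h ρ c ρ' CK : ℝ) (g U f K : ℝ → ℝ) (F : Set E3 → ℝ), LocalisedCertificate a h ρ c ρ' CK g U f K F

/-- **Statement 2 (S2, `stub_energyUpperBound`, M).**  TRIAL-STATE UPPER BOUND, verbatim the route's support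
item `TrialStateUpper` (stmt-AtomisticToContinuum-11963, refuter-reviewed TRUE/M; `energyUpperBound_iff`):
for every periodic `Q` and `ε > 0`, eventually `E(N)/N ≤ e(Q) + ε` (finite blocks of `Q` as trial states,
boundary `O(N^{2/3})` particles lose `O(1)` each by the summable `r⁻⁶` tail, `hasSum_lennardJones_dist_three`).
Used at `Q = P`: with the certificate's lower bound it makes the TOTAL slack of an `o(N)`-excess sequence `o(N)`.
Sources: BlancLewin2015 §2. -/
def EnergyUpperBound : Prop :=
  ∀ (Q : PeriodicConfiguration 3) (ε : ℝ), 0 < ε → ∀ᶠ N : ℕ in Filter.atTop,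
    groundStateEnergy lennardJones 3 N / N ≤ Q.energyPerParticle lennardJones + ε

/-- **Statement 3 (S3, `stub_extraction`, L — zero-slack EXTRACTION).**  For a localised certificate with
`P = hcpPeriodicConfiguration a h` and `limsup E(N)/N ≤ e(P)`: if `RigidFor P` fails, there is a
`1/3`-separated configuration `X ∋ 0` with every star `F`-tight, every pair `U`-tight, SILENT for `K`
(`Σ_{q ∈ X} K(|y − q|) = 0` as a `HasSum`, at every `y`), and NOT root-matched to `P` at some `(R, ε)`, `ε > 0`.
Why true (paper proof, all inputs in tree): failure gives `(R, ε)`, `θ > 0` and an `o(N)`-excess injective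
sequence with `≥ θN` bad particles; total slack `S_N = Σ_i F + Σ_{i<j} U + ½∫Φ² ≤ (E − E(N)) + (E(N) − N e(P))
= o(N)` (split, smearing identity, `F_certifies`, S2); `1/3`-thinning (removal inequality of
`LennardJonesMinimalDistance_holds`: a particle with a neighbour closer than `1/3` has site energy `> 10⁴`, and
`E(N − k) ≥ E(N)`) removes `o(N)` particles and changes bad counts by `o(N)`; Markov on the local densities
`σ_i^{(L)}` (stars, pairs and `∫_{B(x_i,L)}Φ²` within `L`, bounded overlap by separation) with a diagonal
`L_N → ∞` picks bad roots with vanishing local slack; translate the root to `0`, extract a local-rubber limit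
`X` (`exists_subseq_forall_eventually_ballMatch`); `F_lsc`, continuity of `U` on `(0,∞)` and locally uniform
convergence of `Φ` (continuity + `(1+r)⁻⁴` tail + separation) pass the three tight conditions to `X`; root-badness
passes to `¬ RootMatched P (R+1) (ε/2) X`.  Why it might fail: only through a gap in this bookkeeping (none
found by three triagers); it uses the crux's energy hypothesis (Disproof `not_rigidForWithoutEnergy`).
Sources: BlancLewin2015 §2.2, BaakeGrimm2013 Rem. 5.6 (local rubber topology), FlatleyTheil2015 (shape). -/
def Extraction : Prop :=
  ∀ (a h ρ c ρ' CK : ℝ) (g U f K : ℝ → ℝ) (F : Set E3 → ℝ)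
    (hC : LocalisedCertificate a h ρ c ρ' CK g U f K F),
    (∀ ε : ℝ, 0 < ε → ∀ᶠ N : ℕ in Filter.atTop, groundStateEnergy lennardJones 3 N / N ≤
      (hcpPeriodicConfiguration hC.a_pos.ne' hC.h_pos.ne').energyPerParticle lennardJones + ε) →
    ¬ RigidFor (hcpPeriodicConfiguration hC.a_pos.ne' hC.h_pos.ne') →
    ∃ X : Set E3, Sep (1 / 3) X ∧ (0 : E3) ∈ X ∧
      (∀ p ∈ X, F (starAt X p ρ') = 0) ∧
      (∀ p ∈ X, ∀ q ∈ X, p ≠ q → U (dist p q) = 0) ∧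
      (∀ y : E3, HasSum (fun q : ↥X => K ‖y - (q : E3)‖) 0) ∧
      ∃ R ε : ℝ, 0 < ε ∧ ¬ RootMatched (hcpPeriodicConfiguration hC.a_pos.ne' hC.h_pos.ne') R ε X

/-- **Statement 4 (S4, `stub_layering`, M–L — LOCAL-TO-GLOBAL LAYERING at relaxed `c/a`).**  Let `0 < a`,
`0 < h` with `h²/a² ∈ (9/16, 3/4]` and `ρ' ≥ 2a`.  If every recentred `ρ'`-star of a nonempty `X ⊆ ℝ³` is the
image under a linear isometry of the recentred `ρ'`-star of some point of SOME Barlow stacking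
`barlowStacking a h s` (`s` a Hägg word, depending on the point), then `X` is ONE Barlow stacking moved by an
isometry of `ℝ³`.  Why plausibly true: at the ideal ratio and radius `a⁺` this is Hales's propagation theorem,
PROVED in tree (`HalesDSP_layerPackings_holds`: fcc/hcp kissing patterns everywhere ⇒ `g '' barlowStacking`);
here the local datum is stronger (exact environments of radius `≥ 2a` see two layers up and down: the layer
plane and both adjacent offsets are read off each star, interlocking fcc regions are handled as in
`LayerPropagation.lean`) and the window keeps adjacent-layer distances in `(0.94a, 1.04a]`, away from
bcc/sc coincidences.  Why it might fail: an exotic locally-Barlow, globally non-layered set at a special `h/a`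
(two non-parallel fault systems must cross, and the crossing line is not locally Barlow — the step to write
down).  Sources: HalesDSP2012 §1.3 (Fig. 1.12), Hales2012 (arXiv:1209.6043) Thm 1, ConwaySloane1999 Ch. 1 §1.3. -/
def Layering : Prop :=
  ∀ (a h ρ' : ℝ), 0 < a → 0 < h → 9 * a ^ 2 < 16 * h ^ 2 → 4 * h ^ 2 ≤ 3 * a ^ 2 → 2 * a ≤ ρ' →
    ∀ X : Set E3, X.Nonempty →
      (∀ p ∈ X, ∃ s : ℤ → ℤ, IsHaggSeq s ∧ ∃ b ∈ barlowStacking a h s, ∃ A : E3 →ₗᵢ[ℝ] E3,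
        starAt X p ρ' = A '' starAt (barlowStacking a h s) b ρ') →
      ∃ s : ℤ → ℤ, IsHaggSeq s ∧ ∃ g : E3 ≃ᵢ E3, X = g '' barlowStacking a h s

/-- **Statement 5 (S5, `stub_silentBarlowIsHcp`, L — SILENCE SELECTS HCP; the card's lever).**  Let
`h²/a² ∈ (9/16, 3/4]` (`τ = 16h²/(3a²) ∈ (3, 4]`), `K` continuous with `|K(r)| ≤ C_K(1+r)⁻⁴` and `RodStrict a h K`.
If a rigidly moved Barlow stacking `X = g '' barlowStacking a h s` through `0` is SILENT
(`Σ_{q ∈ X} K(|y − q|) = 0` for every `y`), then `X = B '' hcp(a,h)` for a LINEAR isometry `B`.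
Why true (paper proof): layer `k` of the stacking contributes a `Λ_a`-periodic function of `y_∥` whose `G`-th
Fourier coefficient is `c_G(y₃ − kh)·ω_G^{L_k}` (`c_G(t) = ∫_{ℝ²} K(√(|u|² + t²)) e^{−2πi⟨G,u⟩} du = O((1+|t|)⁻²)`,
`ω_G = e^{−2πi⟨G,w⟩}`, `L = haggLabel s`); absolute convergence (decay + separation) and uniqueness of Fourier
coefficients turn silence into the 1-D convolution identities `Σ_k c_G(t − kh) ω_G^{L_k} = 0 ∀ t`; on the rod
`G = u*` (class `1`, `ω` a primitive cube root) the multiplier `ĉ_G(ξ₃) = 𝓕K(G, ξ₃)` vanishes on `|ξ₃| ≤ 1/h` only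
at the sphere heights `ζ² ∈ {0, 1, 4, 4 − τ}` (`RodStrict`), so by `L¹`-Wiener division the `1/h`-periodic
spectrum of the bounded sequence `u_k = ω^{L_k}` lies in `{ζ ∈ {0, 1} + 2ℤ}` (the two members of `ζ₀ + 2ℤ` in
`[−2, 2)` are both sphere heights only for `ζ₀ ∈ ℤ`: `rodAlias_onlyHcp` / `RodOne.onlyIntegerProgressions_one`);
a bounded sequence with spectrum in `(1/2h)ℤ` is `α + β(−1)^k`, so `L_{k+2} ≡ L_k (mod 3)`, `s_{k+1} = −s_k`:
the word is alternating, `X` is a moved `hcpStacking a h`, and `hcpStacking_homogeneous` (+ `0 ∈ X`) makes the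
isometry linear.  Why it might fail: only in the distribution-theoretic bookkeeping (tempered `1/h`-periodic
spectrum of a bounded sequence; finite order at the support points) — no Lev–Olevskii-type rigidity is invoked.
Sources: CohnKumar2006 §9 (Poisson summation with structure factor), ConwaySloane1999 Ch. 4 (hcp reciprocal
set), card calc/rods.py + triage j009339/j009376 (alias tables); the 1-D step is Rudin, *Functional Analysis* (2nd ed.)
Thm 9.3 + proof of Thm 9.13 (`f ∗ φ = 0`, `φ ∈ L^∞` ⇒ `supp φ̂ ⊆ Z(f̂)`; support in a point ⇒ polynomial ⇒ constant),
lit `book:rudin1991-functional-analysis-2nd-ed` PDF pp. 171, 177. -/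
def SilentBarlowIsHcp : Prop :=
  ∀ (a h CK : ℝ) (ha : 0 < a) (hh : 0 < h), 9 * a ^ 2 < 16 * h ^ 2 → 4 * h ^ 2 ≤ 3 * a ^ 2 →
    ∀ K : ℝ → ℝ, Continuous K → (∀ r : ℝ, 0 ≤ r → |K r| ≤ CK / (1 + r) ^ 4) → RodStrict a h K →
      ∀ s : ℤ → ℤ, IsHaggSeq s → ∀ g : E3 ≃ᵢ E3, (0 : E3) ∈ g '' barlowStacking a h s →
        (∀ y : E3, HasSum (fun q : ↥(g '' barlowStacking a h s) => K ‖y - (q : E3)‖) 0) →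
        ∃ B : E3 →ₗᵢ[ℝ] E3,
          g '' barlowStacking a h s = B '' (hcpPeriodicConfiguration ha.ne' hh.ne').points

/-! ### Registered stubs (the ONLY `sorry`s of the file) -/

/-- STUB 1 — existence of the localised exact certificate (Statement 1; the transfer `C⁺`, hardest). -/
theorem stub_certificate : CertificateExists := by
  sorry

/-- STUB 2 — trial-state upper bound `limsup E(N)/N ≤ e(Q)` (Statement 2 = route item 11963). -/
theorem stub_energyUpperBound : EnergyUpperBound := by
  sorry

/-- STUB 3 — zero-slack extraction by Markov / thinning / local compactness (Statement 3). -/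
theorem stub_extraction : Extraction := by
  sorry

/-- STUB 4 — local-to-global layering of exact Barlow environments (Statement 4). -/
theorem stub_layering : Layering := by
  sorry

/-- STUB 5 — a silent Barlow stacking with a rod-strict kernel is hcp (Statement 5; the lever). -/
theorem stub_silentBarlowIsHcp : SilentBarlowIsHcp := by
  sorry

/-! ### Name-keyed aliases of the five statements (hypotheses of the composition)

`__Registered.stub_X` is statement `X` under the registered stub's short name, so that the native skeleton
audit (`#h21_check_skeleton`: hypotheses admissible iff registered obligations / declared stubs BY NAME)
accepts `SlackRigidity_of : __Registered.stub_… → … → SlackRigidity` (device of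
`Cruxes/DefectFreeCrystallizes/Lines/octet-cell-squeeze.lean`); `slackRigidity_skeleton` applies the
composition to the five `stub_…` literally, which checks that statements, aliases and stubs agree. -/
namespace __Registered

/-- Alias of `CertificateExists` keyed by the registered stub name. -/
abbrev stub_certificate : Prop := CertificateExists
/-- Alias of `EnergyUpperBound` keyed by the registered stub name. -/
abbrev stub_energyUpperBound : Prop := EnergyUpperBound
/-- Alias of `Extraction` keyed by the registered stub name. -/
abbrev stub_extraction : Prop := Extraction
/-- Alias of `Layering` keyed by the registered stub name. -/
abbrev stub_layering : Prop := Layering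
/-- Alias of `SilentBarlowIsHcp` keyed by the registered stub name. -/
abbrev stub_silentBarlowIsHcp : Prop := SilentBarlowIsHcp

end __Registered

/-! ### Glue lemmas (sorry-free) -/

/-- Readback: Statement 2 is literally the route's support item `TrialStateUpper` (stmt-11963). -/
theorem energyUpperBound_iff : EnergyUpperBound ↔ TrialStateUpper := Iff.rfl

/-- A linearly rotated copy of `P` is matched at the root at every `(R, ε)`, `ε ≥ 0`. -/
theorem rootMatched_image (P : PeriodicConfiguration 3) (A : E3 →ₗᵢ[ℝ] E3) {R ε : ℝ} (hε : 0 ≤ ε) :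
    RootMatched P R ε (A '' P.points) := by
  refine ⟨A, fun p hp _ => ⟨A p, ⟨p, hp, rfl⟩, by simpa using hε⟩, ?_⟩
  rintro q ⟨p, hp, rfl⟩ _
  exact ⟨p, hp, by simpa using hε⟩

/-! ### The composition (kernel-checked, no `sorry`) -/

/-- **`SlackRigidity` from the five stubs.**  Witness `P := hcpPeriodicConfiguration (a, h)` of the certificate
(S1).  If `RigidFor P` failed, S3 (fed by S2 at `Q = P`) would extract a `1/3`-separated, rooted, tight,
`U`-tight, silent `X` not root-matched at some `(R, ε)`; the certificate's tight locus makes every star of `X`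
a Barlow environment, S4 makes `X` a moved Barlow stacking, S5 makes it `B '' P.points` — which is root-matched
at every `(R, ε)`: contradiction. -/
theorem SlackRigidity_of (h₁ : __Registered.stub_certificate) (h₂ : __Registered.stub_energyUpperBound)
    (h₃ : __Registered.stub_extraction) (h₄ : __Registered.stub_layering)
    (h₅ : __Registered.stub_silentBarlowIsHcp) : SlackRigidity := by
  obtain ⟨a, h, ρ, c, ρ', CK, g, U, f, K, F, hC⟩ := h₁
  rw [slackRigidity_iff]
  refine ⟨hcpPeriodicConfiguration hC.a_pos.ne' hC.h_pos.ne', ?_⟩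
  by_contra hP
  -- S2 at `Q = P`, then S3: a rooted zero-slack configuration that is not root-matched
  have hE := h₂ (hcpPeriodicConfiguration hC.a_pos.ne' hC.h_pos.ne')
  obtain ⟨X, hsep, h0, hF, hU, hsil, R, ε, hε, hbad⟩ := h₃ a h ρ c ρ' CK g U f K F hC hE hP
  -- the certificate's weak tight locus: every star of `X` is a Barlow environment
  have hloc : ∀ p ∈ X, ∃ s : ℤ → ℤ, IsHaggSeq s ∧ ∃ b ∈ barlowStacking a h s, ∃ A : E3 →ₗᵢ[ℝ] E3,
      starAt X p ρ' = A '' starAt (barlowStacking a h s) b ρ' :=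
    fun p hp => hC.tight X hsep p hp (hF p hp) (fun q hq q' hq' _ _ hne => hU q hq q' hq' hne)
  -- S4: `X` is one rigidly moved Barlow stacking
  obtain ⟨s, hs, giso, hX⟩ :=
    h₄ a h ρ' hC.a_pos hC.h_pos hC.window.1 hC.window.2 hC.radius X ⟨0, h0⟩ hloc
  subst hX
  -- S5: silence selects hcp, through `0`, by a LINEAR isometry
  obtain ⟨B, hB⟩ := h₅ a h CK hC.a_pos hC.h_pos hC.window.1 hC.window.2 K hC.K_cont hC.K_decay
    hC.rod_strict s hs giso h0 hsil
  -- a rotated copy of `P` is root-matched at every `(R, ε)`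
  apply hbad
  rw [hB]
  exact rootMatched_image _ B hε.le

/-- The crux from the registered stubs (the lead's closing theorem: sorry-free once every `stub_*` is
replaced by its landed helper; its type is literally the route decl). -/
theorem slackRigidity_skeleton : SlackRigidity :=
  SlackRigidity_of stub_certificate stub_energyUpperBound stub_extraction stub_layering
    stub_silentBarlowIsHcp

/-! ### Sanity: Statement 1 is crux 11959 strengthened (sorry-free) -/

/-- The weighted smearing identity: for `f = K ⋆ K`,
`Σᵢ Σⱼ wᵢ wⱼ f(|yᵢ − yⱼ|) = ∫ (Σⱼ wⱼ K(|z − yⱼ|))² dz` (proof as in `IdeatorThreeSketch.smearing_identity`). -/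
theorem smearing_identity {f K : ℝ → ℝ} (hfK : IsSmearingOf f K) {n : ℕ} (y : Fin n → E3)
    (w : Fin n → ℝ) :
    ∑ i, ∑ j, w i * w j * f (dist (y i) (y j)) = ∫ z : E3, (∑ j, w j * K ‖z - y j‖) ^ 2 := by
  classical
  have hterm : ∀ i j, Integrable (fun z : E3 => w i * w j * (K ‖z - y i‖ * K ‖z - y j‖)) :=
    fun i j => (hfK.1 (y i) (y j)).const_mul (w i * w j)
  symm
  calc ∫ z : E3, (∑ j, w j * K ‖z - y j‖) ^ 2
      = ∫ z : E3, ∑ i, ∑ j, w i * w j * (K ‖z - y i‖ * K ‖z - y j‖) := by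
        congr 1
        funext z
        rw [sq, Finset.sum_mul_sum]
        refine Finset.sum_congr rfl fun i _ => Finset.sum_congr rfl fun j _ => ?_
        ring
    _ = ∑ i, ∫ z : E3, ∑ j, w i * w j * (K ‖z - y i‖ * K ‖z - y j‖) := by
        rw [integral_finsetSum]
        intro i _
        exact integrable_finsetSum _ fun j _ => hterm i j
    _ = ∑ i, ∑ j, ∫ z : E3, w i * w j * (K ‖z - y i‖ * K ‖z - y j‖) := by
        refine Finset.sum_congr rfl fun i _ => ?_
        rw [integral_finsetSum]
        intro j _
        exact hterm i j
    _ = ∑ i, ∑ j, w i * w j * f (dist (y i) (y j)) := by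
        refine Finset.sum_congr rfl fun i _ => Finset.sum_congr rfl fun j _ => ?_
        rw [integral_const_mul, hfK.2 (y i) (y j)]

/-- A smearing representation implies the route's inlined positive-type clause. -/
theorem posType_of_smearing {f K : ℝ → ℝ} (hfK : IsSmearingOf f K) :
    ∀ (n : ℕ) (y : Fin n → E3) (w : Fin n → ℝ), 0 ≤ ∑ i, ∑ j, w i * w j * f (dist (y i) (y j)) := by
  intro n y w
  rw [smearing_identity hfK y w]
  exact integral_nonneg fun z => sq_nonneg _

/-- Star-form certification implies `c`-stability of `g` (`F ≥ 0`). -/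
theorem stable_of_certificate {a h ρ c ρ' CK : ℝ} {g U f K : ℝ → ℝ} {F : Set E3 → ℝ}
    (hC : LocalisedCertificate a h ρ c ρ' CK g U f K F) (N : ℕ) (x : Fin N → E3)
    (hx : Function.Injective x) : -(c * (N : ℝ)) ≤ interactionEnergy g x := by
  have h1 := hC.F_certifies N x hx
  have h2 : 0 ≤ ∑ i, F (starAt (range x) (x i) ρ') := Finset.sum_nonneg fun i _ => hC.F_nonneg _
  linarith

/-- **Statement 1 ⇒ `ExactCertificate` (crux 11959)**: the localised certificate is a genuine strengthening of
the route's rank-3 crux (so S1 carries 11959's difficulty plus the localisation/strictness constraints, and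
nothing of `SlackRigidity` itself). -/
theorem certificate_implies_exactCertificate (h₁ : CertificateExists) : ExactCertificate := by
  obtain ⟨a, h, ρ, c, ρ', CK, g, U, f, K, F, hC⟩ := h₁
  exact ⟨hcpPeriodicConfiguration hC.a_pos.ne' hC.h_pos.ne', ρ, c, g, U, f, hC.split, hC.U_nonneg,
    hC.g_range, posType_of_smearing hC.smear, fun N x hx => stable_of_certificate hC N x hx, hC.exact⟩

end Summit.AtomisticToContinuum.Crystallization.Cruxes.SlackRigidity.SignedRootSilentField

end
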